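import Mathlib
import HarnessLib
import Literature.Combinatorics.Additive.StepBeyondKempermanSizeThree

/-!
# Grynkiewicz 2009, §6 Claim 9: the terminal computation `A = {0, d, x}`, `B = {0, d, x, b}`

[cite: Grynkiewicz2009, §6 Claim 9 (proof of Thm 4.1, pp. 28–29)] [tag: critical-pair] [tag: inverse-theorem]

Topic `Literature/Combinatorics/Additive`.  Cell `mm-stpp` (D-0046), seat `mm-stpp-lit` (gen 23); the
port of D. J. Grynkiewicz, *A step beyond Kemperman's structure theorem*, Mathematika **55** (2009)
67–114 continued.  §6, Claim 9 («w.l.o.g. `|A| ≥ |B| ≥ 4`»), last paragraph (print pp. 28–29): after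
the induction on `|B|` has reduced the case `|A| = 3` to «`|B| = 4` and w.l.o.g. `A = {0, d, x}` and
`B = {0, d, x, b}` with `N₁ᵇ(A, B) = {x + b}`», the print concludes: «Since `d⊆(A, 𝒜𝒫) ≥ 2` (eq. (51)),
then it follows that `x ∉ {2d, 3d, −d, −2d}`, `d ∉ {2x, 3x, −x, −2x}` and
`0 ∉ {2x − d, 3x − 2d, 2d − x, 3d − 2x}`.  Additionally, `A` not quasi-periodic (Claim 4) with `|A| = 3`
implies `A` does not contain a coset of an order two subgroup.  Hence the previous two sentences yield
that `{0, d, 2d}`, `{x, x + d}`, `{2x}` are the three distinct `d`-components of `A + A ⊆ A + B`: this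
is because `A + A = {0, d, x} + {0, d, x} = {0, d, 2d, x, x + d, 2x}` while the previous two sentences
ensure that all these 6 elements are distinct and that `{−d, 3d, x − d, x + 2d, 2x − d, 2x + d}` is
disjoint from `{0, d, 2d, x, x + d, 2x}`.  Since `|A + B| = 7`, it follows that `b + A` contains exactly
one element distinct from these 6.  Since `N₁ᵇ(A, B) = {x + b}`, it follows that this element must be
`x + b`.  Thus the component `{0, d} + b` of `b + A` must be contained in either `{0, d, 2d}` or
`{x, x + d}`, whence `b = 0`, `d` or `x`, all contradictions, completing the induction.»

This file is that computation, with the inequalities it uses as explicit hypotheses (the caller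
derives them from (51), (47) and Claim 4).  NOTE on the printed list: the disjointness of
`{−d, 3d, …, 2x + d}` from `A + A` also needs `3d ≠ 0` and `2x + d ≠ 0`, which the print does not list;
they follow from (47) (`3d = 0` makes `A ∪ {2d} = ⟨d⟩ ∪ {x}` quasi-periodic) and from (51)
(`d = −2x` puts `A` inside the progression `{−2x, −x, 0, x}`), and are carried here as hypotheses too.
Only the part of the list actually used appears.

MAIN RESULT (0 definitions, 0 named facts; everything PROVED).
* `Grynkiewicz2009.claim9_terminal` — for `A = {0, d, x}`, `B = {0, d, x, b}` (`b ∉ A`) with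
  `|A + B| = 7`, `x + b ∉ A + A` (i.e. `x + b` uniquely expressed) and the listed inequalities: `False`.

## References
* D. J. Grynkiewicz, *A step beyond Kemperman's structure theorem*, Mathematika 55 (2009) 67–114,
  doi:10.1112/S0025579300000966, §6 Claim 9 (pp. 28–29) [cite: Grynkiewicz2009, Thm 4.1 (proof,
  Claim 9)] — held `paper:doi-10-1112-s0025579300000966`, p0028–p0029 read 2026-08-29.
-/

namespace Literature.Combinatorics.Additive

open Finset
open scoped Pointwise

universe u

variable {G : Type u} [AddCommGroup G] [DecidableEq G]

namespace Grynkiewicz2009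

omit [DecidableEq G] in
/-- Linear rearrangement: `P = Q` from `R = S` when `P − Q = R − S`. [folklore] -/
private theorem eq_of_abel' {P Q R S : G} (h : R = S) (e : P - Q = R - S) : P = Q := by
  rw [← sub_eq_zero] at h ⊢; rwa [e]

omit [DecidableEq G] in
/-- Linear rearrangement: `P ≠ Q` from `R ≠ S` when `P − Q = R − S`. [folklore] -/
private theorem ne_of_abel' {P Q R S : G} (h : R ≠ S) (e : P - Q = R - S) : P ≠ Q :=
  fun hPQ => h (eq_of_abel' hPQ e.symm)

/-- **Claim 9, terminal computation.**  `A = {0, d, x}`, `B = {0, d, x, b}` with `b ∉ A`,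
`|A + B| = 7`, `x + b ∉ A + A` («`N₁ᵇ(A, B) = {x + b}`»), no coset of an order-two subgroup inside `A`
(`2d, 2x, 2(x − d) ≠ 0`), and the progression exclusions `x ∉ {2d, 3d, −d, −2d}`, `d ≠ 2x`,
`3d − 2x ≠ 0` of (51), together with `3d ≠ 0`, `2x + d ≠ 0` (see the module docstring): impossible.
Proof as printed: `A + A = {0, d, 2d, x, x + d, 2x}` has six distinct elements, `A + B = (A + A) ∪ (b + A)`
has seven, the new one is `x + b`, so `b, b + d ∈ A + A`, and the `d`-step from `b` to `b + d` inside
`{0, d, 2d} ∪ {x, x + d} ∪ {2x}` forces `b ∈ {0, d, x} = A`.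
[cite: Grynkiewicz2009, §6 Claim 9 (proof of Thm 4.1, pp. 28–29)] -/
theorem claim9_terminal {A B : Finset G} {d x b : G} (hA : A = {0, d, x}) (hB : B = insert b A)
    (hbA : b ∉ A) (hAB7 : #(A + B) = 7) (huniq : x + b ∉ A + A)
    (hd0 : d ≠ 0) (hx0 : x ≠ 0) (hxd : x ≠ d) (h2d : d + d ≠ 0) (h2x : x + x ≠ 0)
    (h2xd : (x - d) + (x - d) ≠ 0) (hx2d : x ≠ d + d) (hx3d : x ≠ d + d + d) (hxnd : x ≠ -d)
    (hxn2d : x ≠ -(d + d)) (hd2x : d ≠ x + x) (h3d : d + d + d ≠ 0)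
    (h3d2x : d + d + d - (x + x) ≠ 0) (h2xpd : x + x + d ≠ 0) : False := by
  -- the six sums of `A + A`
  have h0A : (0 : G) ∈ A := by rw [hA]; simp
  have hdA : d ∈ A := by rw [hA]; simp
  have hxA : x ∈ A := by rw [hA]; simp
  have hAAsub : ({0, d, d + d, x, x + d, x + x} : Finset G) ⊆ A + A := by
    intro w hw
    simp only [mem_insert, mem_singleton] at hw
    rcases hw with rfl | rfl | rfl | rfl | rfl | rfl
    · simpa using add_mem_add h0A h0A
    · simpa using add_mem_add h0A hdA
    · exact add_mem_add hdA hdA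
    · simpa using add_mem_add hxA h0A
    · exact add_mem_add hxA hdA
    · exact add_mem_add hxA hxA
  have hAAsup : A + A ⊆ ({0, d, d + d, x, x + d, x + x} : Finset G) := by
    intro w hw
    obtain ⟨u, hu, v, hv, rfl⟩ := mem_add.1 hw
    rw [hA] at hu hv
    simp only [mem_insert, mem_singleton] at hu hv ⊢
    rcases hu with rfl | rfl | rfl <;> rcases hv with rfl | rfl | rfl
    · exact Or.inl (by rw [add_zero])
    · exact Or.inr (Or.inl (by rw [zero_add]))
    · exact Or.inr (Or.inr (Or.inr (Or.inl (by rw [zero_add]))))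
    · exact Or.inr (Or.inl (by rw [add_zero]))
    · exact Or.inr (Or.inr (Or.inl rfl))
    · exact Or.inr (Or.inr (Or.inr (Or.inr (Or.inl (by rw [add_comm])))))
    · exact Or.inr (Or.inr (Or.inr (Or.inl (by rw [add_zero]))))
    · exact Or.inr (Or.inr (Or.inr (Or.inr (Or.inl rfl))))
    · exact Or.inr (Or.inr (Or.inr (Or.inr (Or.inr rfl))))
  have hAA : A + A = ({0, d, d + d, x, x + d, x + x} : Finset G) := Subset.antisymm hAAsup hAAsub
  -- they are distinct
  have f1 : (0 : G) ∉ ({d, d + d, x, x + d, x + x} : Finset G) := by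
    simp only [mem_insert, mem_singleton, not_or]
    exact ⟨hd0.symm, h2d.symm, hx0.symm, ne_of_abel' hxnd.symm (by abel), h2x.symm⟩
  have f2 : d ∉ ({d + d, x, x + d, x + x} : Finset G) := by
    simp only [mem_insert, mem_singleton, not_or]
    exact ⟨ne_of_abel' hd0.symm (by abel), hxd.symm, ne_of_abel' hx0.symm (by abel), hd2x⟩
  have f3 : d + d ∉ ({x, x + d, x + x} : Finset G) := by
    simp only [mem_insert, mem_singleton, not_or]
    exact ⟨hx2d.symm, ne_of_abel' hxd.symm (by abel), ne_of_abel' h2xd.symm (by abel)⟩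
  have f4 : x ∉ ({x + d, x + x} : Finset G) := by
    simp only [mem_insert, mem_singleton, not_or]
    exact ⟨ne_of_abel' hd0.symm (by abel), ne_of_abel' hx0.symm (by abel)⟩
  have f5 : x + d ≠ x + x := ne_of_abel' hxd.symm (by abel)
  have hAA6 : #(A + A) = 6 := by
    rw [hAA, card_insert_of_notMem f1, card_insert_of_notMem f2, card_insert_of_notMem f3,
      card_insert_of_notMem f4, card_pair f5]
  -- `A + B = (A + A) ∪ {x + b}`, so `b, b + d ∈ A + A`
  have hABeq : A + B = (A + A) ∪ (A + {b}) := by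
    rw [hB, insert_eq, add_union, union_comm]
  have hxb : x + b ∈ A + B := by rw [hB]; exact add_mem_add hxA (mem_insert_self _ _)
  have hsub : insert (x + b) (A + A) ⊆ A + B :=
    insert_subset hxb (by rw [hABeq]; exact subset_union_left)
  have heq : insert (x + b) (A + A) = A + B :=
    eq_of_subset_of_card_le hsub (by rw [card_insert_of_notMem huniq]; omega)
  have hbmem : b ∈ A + A := by
    have : b ∈ A + B := by
      rw [hB]; simpa using add_mem_add h0A (mem_insert_self b A)
    rw [← heq, mem_insert] at this
    exact this.resolve_left (ne_of_abel' hx0.symm (by abel))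
  have hbdmem : d + b ∈ A + A := by
    have : d + b ∈ A + B := by rw [hB]; exact add_mem_add hdA (mem_insert_self b A)
    rw [← heq, mem_insert] at this
    exact this.resolve_left (ne_of_abel' hxd.symm (by abel))
  have hb0 : b ≠ 0 := fun h => hbA (by rw [h]; exact h0A)
  have hbd : b ≠ d := fun h => hbA (by rw [h]; exact hdA)
  have hbx : b ≠ x := fun h => hbA (by rw [h]; exact hxA)
  rw [hAA] at hbmem hbdmem
  simp only [mem_insert, mem_singleton] at hbmem hbdmem
  -- `b ∈ {2d, x + d, 2x}` and `b + d ∈ A + A`: each combination is excluded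
  rcases hbmem with hb | hb | hb | hb | hb | hb
  · exact hb0 hb
  · exact hbd hb
  · subst hb
    rcases hbdmem with h | h | h | h | h | h
    · exact h3d (eq_of_abel' h (by abel))
    · exact h2d (eq_of_abel' h (by abel))
    · exact hd0 (eq_of_abel' h (by abel))
    · exact hx3d (eq_of_abel' h.symm (by abel))
    · exact hx2d (eq_of_abel' h.symm (by abel))
    · exact h3d2x (eq_of_abel' h (by abel))
  · exact hbx hb
  · subst hb
    rcases hbdmem with h | h | h | h | h | h
    · exact hxn2d (eq_of_abel' h (by abel))
    · exact hxnd (eq_of_abel' h (by abel))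
    · exact hx0 (eq_of_abel' h (by abel))
    · exact h2d (eq_of_abel' h (by abel))
    · exact hd0 (eq_of_abel' h (by abel))
    · exact hx2d (eq_of_abel' h.symm (by abel))
  · subst hb
    rcases hbdmem with h | h | h | h | h | h
    · exact h2xpd (eq_of_abel' h (by abel))
    · exact h2x (eq_of_abel' h (by abel))
    · exact hd2x (eq_of_abel' h.symm (by abel))
    · exact hxnd (eq_of_abel' h (by abel))
    · exact hx0 (eq_of_abel' h (by abel))
    · exact hd0 (eq_of_abel' h (by abel))

end Grynkiewicz2009

end Literature.Combinatorics.Additive
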